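import Summits.AtomisticToContinuum.Crystallization.Theorems.OverbindingBudgetAffineCompressedCutCharts

/-!
# `OverbindingBudget` / crux `RobustDefectLimitWindows` (stmt-AtomisticToContinuum-31280) — «RunCut»: STAR KERNEL (part 23A-β, the combinatorial half of the bond carry)

Order (2c), ρ₁ = 30; plan of record memo `decomp-a2c-lens-4/g89/memo/ATLAS-STAR-g89.md` §5 (critic rows 1619/1621 (D)); python twins
`g89/memo/star_kernel.py` (environments ⊇ forced set) and `g90/memo/sk_twin.py` (THIS Boolean, same quantifier skeleton; all tables agree).
The legs of part 23 carry a `{111}`-type STAR MEMBER of the current site's standard model across each first-shell bond and re-standardise at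
the child.  What is combinatorial about one bond is finite and is settled here by kernel computation, in the data model of the tree's exact
adjacency kernel `…CompressedCutKernel` (integer triples `T3 = √18 × model`, `tetraPick`, `regB`/`RegAt`, `tpull = d • R₁`) and its bridge
`…CompressedCutCharts` (`ChartDict`, `Carries`, `mv`, `mv_tpull`, `regAt_of_chartDict`, `exists_unitTriple_of_chartDict`):
* §1 the STAR LISTS at scale `×3` (so that the hcp lower-side members `(4/3,4/3,−20/3)` are integral): `XF` (fcc: the four `(4,±4,±4)` lines, 8 vectors),
  `XH` (hcp: axis `(4,4,4)`, three upper-side `(4,4,−4)`-type and three lower-side `(4/3,4/3,−20/3)`-type lines, 14 vectors), `XHax` (the axis, 2);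
  all of `tsq = 432` (`‖⅓·mv X‖² = 8/3`); the list facts (K2) `XH_dichotomy` (a member of `XH` is `±`axis or meets the axis at model cosine `±1/3`:
  `tdot = ±144`) and `XF_pairs` / `XHax_XH_pairs`;
* §2 the Boolean STAR KERNEL `starKernelB P x S XP XS` — SAME quantifier skeleton as `kernelB` (frame `(x; b, c) = tetraPick P x`, all unit triples of the
  child list `S`, single-parent registration `regB … x`) with the conclusion `∀ X ∈ XP, ∃ Y ∈ XS, tpull (−x, b−x, c−x; w) Y = d • X` ((K1): the parent's
  star member `X` is the image of a child star member `Y` under the exact dictionary) — and its soundness `starKernelB_sound` (Prop form `StarPulls`);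
* §3 the (K3) REPRESENTATION SEARCH `repB P x X` (face type `X = ±2(−x + (v_a − x) + (v_b − x))` or zero-sum quad type
  `X = ±(2(v_a − x) + (v_b − x) − 2(v_c − x) − (v_d − x))`, labels within the dictionary reach `0 < tsq (v − x) ≤ 36`), read back in REAL FORM as
  `face_real_of_faceRepB` (`(1/3)·mv X = −(c·mv x) + c·(mv v_a − mv x) + c·(mv v_b − mv x)`, `|c| = 2/3`: the vector of `…RunCutBondLink.face_link`,
  constant 16/3 by `face_link_record`) and `quad_real_of_quadRepB` (moduli `2/3, 1/3, 2/3, 1/3`, zero sum: `quad_link`, constant 4), and the OWN-FACE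
  SEARCH `ownFaceB P X` (`(1/3)·mv X = c·mv u₁ + c·mv u₂ + c·mv u₃`, first-shell `uᵢ`, `|c| = 2/3` — feeds `…RunCutBondLink.near_isometry_combo3` /
  `norm_face_lower` with `norm_third_mv_sq`);
* §4 the TABLES by `decide +kernel`: `sk_ff`, `sk_fh` (fcc parent, all twelve bonds, any of its four lines ↦ a star member of the fcc / hcp child),
  `sk_hf`, `sk_hh` (hcp parent, all twelve bonds, its AXIS ↦ a star member of the child; basal bonds: `sk_hh_basal` the axis exactly), the
  never-arising row `sk_hh_side_false` (an hcp parent does NOT carry its side members: the 36 violations of memo §5 — kernel value `false`, the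
  pre-registered must-fail of critic row 1621 (D)), `rep_table`, `ownFace_table`;
* §5 the BRIDGE to `E3`: ★★ `star_step_one` (table entry + chart-form dictionary + parent chart ⇒ `∀ X ∈ XP, ∃ Y ∈ XS, G (mv Y) = mv X`),
  `norm_third_mv_sq`, `inner_mv` (so (K2) reads: model cosine `±1/3` or `±1`), `mv_axis_three`.
Deps: tree `…CompressedCutCharts` only.  No `instance`, no `notation`, no `set_option`, no new axioms, 0 sorry.
-/

namespace Summit.AtomisticToContinuum.Crystallization.Theorems.OverbindingBudgetAffineRunCutStarKernel

open scoped InnerProductSpace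
open Literature.Geometry.DiscreteGeometry (intVec)
open Summit.AtomisticToContinuum.Crystallization.Theorems.OverbindingBudgetAffineCompressedCutKernel (T3 tsub tadd tneg tscale tsq thsum teq tdet
  tpull impB impB_eq_true teq_eq_true fccL hcpL hexL capL tetraPick tetraOkB regB RegAt TetraAt UnitTriple toV toV_apply_zero toV_apply_one toV_apply_two)
open Summit.AtomisticToContinuum.Crystallization.Theorems.OverbindingBudgetAffineCompressedCutCharts (mv mv_tsub mv_tadd mv_tneg mv_tscale mv_injective
  norm_mv_sq norm_mv_eq_one_iff ListedBy Carries ChartDict regAt_of_chartDict exists_unitTriple_of_chartDict mv_tpull tdet_of_unitTriple)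

/-! ## §1  Star lists (scale `×3`) and their list facts -/

/-- Integer dot product. [this file] -/
def tdot (a b : T3) : ℤ := a.1 * b.1 + a.2.1 * b.2.1 + a.2.2 * b.2.2

/-- First-shell points of a list. [this file] -/
def shellL (P : List T3) : List T3 := P.filter fun v => tsq v == 18

/-- `3 ×` the fcc star: the four `{111}`-type lines `(2/3)(u₁ + u₂ + u₃)` over the triangular faces of the cuboctahedron, both signs. [this file] -/
def XF : List T3 :=
  [(12, 12, 12), (-12, -12, -12), (12, 12, -12), (-12, -12, 12), (12, -12, 12), (-12, 12, -12), (12, -12, -12), (-12, 12, 12)]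

/-- `3 ×` the hcp star (tree convention `hcpL`: basal plane `x + y + z = 0`, caps `(3,3,0)`-type above, `(−1,−1,−4)`-type below): the axis `(4,4,4)`,
the three upper-side lines `(4,4,−4)`-type and the three lower-side lines `(4/3,4/3,−20/3)`-type, both signs. [this file] -/
def XH : List T3 :=
  [(12, 12, 12), (-12, -12, -12), (12, 12, -12), (-12, -12, 12), (12, -12, 12), (-12, 12, -12), (-12, 12, 12), (12, -12, -12),
   (4, 4, -20), (-4, -4, 20), (4, -20, 4), (-4, 20, -4), (-20, 4, 4), (20, -4, -4)]

/-- `3 ×` the hcp axis, both signs. [this file] -/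
def XHax : List T3 := [(12, 12, 12), (-12, -12, -12)]

/-- All star members have `tsq = 432` (`= 18 · 24`; `‖⅓ mv X‖² = 8/3`) and the axis list is contained in `XH`. [this file, by `decide`] -/
theorem star_lists_shape :
    (∀ X ∈ XF, tsq X = 432) ∧ (∀ Y ∈ XH, tsq Y = 432) ∧ (∀ X ∈ XHax, X ∈ XH) ∧ (∀ X ∈ XHax, tsq X = 432) := by
  refine ⟨?_, ?_, ?_, ?_⟩ <;> decide

/-- **(K2) THE HCP DICHOTOMY** as a list fact: a member of the hcp star is `±`axis or meets the axis `(12,12,12)` at `tdot = ±144` (model cosine `±1/3`: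
`144 = 432/3`). [this file, by `decide`] -/
theorem XH_dichotomy : ∀ Y ∈ XH, Y ∈ XHax ∨ tdot Y (12, 12, 12) = 144 ∨ tdot Y (12, 12, 12) = -144 := by decide

/-- The fcc star lines pairwise: equal up to sign (`tdot = ±432`) or at model cosine `±1/3` (`tdot = ±144`). [this file, by `decide`] -/
theorem XF_pairs : ∀ X ∈ XF, ∀ X' ∈ XF, tdot X X' = 432 ∨ tdot X X' = -432 ∨ tdot X X' = 144 ∨ tdot X X' = -144 := by decide

/-- The hcp axis against every hcp star member: `tdot ∈ {±432, ±144}`. [this file, by `decide`] -/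
theorem XHax_XH_pairs : ∀ X ∈ XHax, ∀ Y ∈ XH, tdot X Y = 432 ∨ tdot X Y = -432 ∨ tdot X Y = 144 ∨ tdot X Y = -144 := by decide

/-! ## §2  The Boolean star kernel and its soundness -/

/-- CONCLUSION of the star kernel for one registered unit triple: every parent star member `X ∈ XP` is `d⁻¹ •` the pull-back of a child star member
`Y ∈ XS`. [this file] -/
def starConclB (XP XS : List T3) (u₁ u₂ u₃ w₁ w₂ w₃ : T3) (d : ℤ) : Bool :=
  XP.all fun X => XS.any fun Y => teq (tpull u₁ u₂ u₃ w₁ w₂ w₃ Y) (tscale d X)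

/-- **The star kernel** (quantifier skeleton of `…CompressedCutKernel.kernelB`, single parent `xr = x`): parent list `P`, child at the first-shell point
`x` with model list `S`, frame `(x; b, c) = tetraPick P x`; for every unit tetrahedral triple `(w₁, w₂, w₃)` of `S` whose pull-back registers the parent's
points adjacent to the child, `starConclB XP XS`. [this file] -/
def starKernelB (P : List T3) (x : T3) (S XP XS : List T3) : Bool :=
  let b := (tetraPick P x).1
  let c := (tetraPick P x).2
  tetraOkB P x b c && (
  S.all fun w₁ => impB (tsq w₁ == 18) <|
  S.all fun w₂ => impB (tsq w₂ == 18 && tsq (tsub w₁ w₂) == 18) <|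
  S.all fun w₃ => impB (tsq w₃ == 18 && tsq (tsub w₁ w₃) == 18 && tsq (tsub w₂ w₃) == 18) <|
    let d := tdet w₁ w₂ w₃
    let pulled := S.map (tpull (tneg x) (tsub b x) (tsub c x) w₁ w₂ w₃)
    impB (regB P pulled d x) (starConclB XP XS (tneg x) (tsub b x) (tsub c x) w₁ w₂ w₃ d))

/-- The star kernel over all children `x ∈ xs`. [this file] -/
def starKernelListB (P xs S XP XS : List T3) : Bool :=
  xs.all fun x => starKernelB P x S XP XS

/-- Prop form of the conclusion. [this file] -/
def StarPulls (XP XS : List T3) (u₁ u₂ u₃ w₁ w₂ w₃ : T3) : Prop :=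
  ∀ X ∈ XP, ∃ Y ∈ XS, tpull u₁ u₂ u₃ w₁ w₂ w₃ Y = tscale (tdet w₁ w₂ w₃) X

/-- `P.any (teq b)` read as membership. [private twin of the `…CompressedCutKernel` lemma, private there] -/
private theorem mem_of_any_teq {P : List T3} {b : T3} (h : P.any (teq b) = true) : b ∈ P := by
  obtain ⟨p, hp, hpb⟩ := List.any_eq_true.1 h
  rw [teq_eq_true] at hpb
  exact hpb ▸ hp

/-- `tetraOkB` read as a unit tetrahedral frame of points of `P`. [private twin of the `…CompressedCutKernel` lemma, private there] -/
private theorem tetraOkB_sound {P : List T3} {x b c : T3} (h : tetraOkB P x b c = true) : b ∈ P ∧ c ∈ P ∧ TetraAt x b c := by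
  simp only [tetraOkB, Bool.and_eq_true, beq_iff_eq] at h
  obtain ⟨⟨hb, hc⟩, ⟨⟨⟨hb₁, hbx⟩, hc₁⟩, hcx⟩, hbc⟩ := h
  exact ⟨mem_of_any_teq hb, mem_of_any_teq hc, hb₁, hbx, hc₁, hcx, hbc⟩

/-- `RegAt` implies the Boolean registration `regB`. [private twin of one direction of `…CompressedCutKernel.regB_true_iff`, private there] -/
private theorem regB_of_regAt {P S : List T3} {x b c w₁ w₂ w₃ : T3} (h : RegAt P S x (tneg x) (tsub b x) (tsub c x) w₁ w₂ w₃) :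
    regB P (S.map (tpull (tneg x) (tsub b x) (tsub c x) w₁ w₂ w₃)) (tdet w₁ w₂ w₃) x = true := by
  simp only [regB, List.all_eq_true, impB_eq_true, beq_iff_eq, List.any_eq_true, List.mem_map, teq_eq_true]
  intro V hV hq
  obtain ⟨W, hW, hp⟩ := h V hV hq
  exact ⟨_, ⟨W, hW, rfl⟩, hp⟩

/-- `starConclB` read as `StarPulls`. [this file] -/
private theorem starPulls_of_starConclB {XP XS : List T3} {u₁ u₂ u₃ w₁ w₂ w₃ : T3}
    (h : starConclB XP XS u₁ u₂ u₃ w₁ w₂ w₃ (tdet w₁ w₂ w₃) = true) : StarPulls XP XS u₁ u₂ u₃ w₁ w₂ w₃ := by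
  simp only [starConclB, List.all_eq_true, List.any_eq_true, teq_eq_true] at h
  intro X hX
  obtain ⟨Y, hY, hYX⟩ := h X hX
  exact ⟨Y, hY, hYX⟩

/-- **Soundness of the star kernel**: the frame `(x; b, c) = tetraPick P x` is a unit tetrahedral frame of points of `P`, and every unit triple of `S`
registering the parent's adjacent points satisfies `StarPulls XP XS`. [this file] -/
theorem starKernelB_sound {P S XP XS : List T3} {x : T3} (h : starKernelB P x S XP XS = true) :
    (tetraPick P x).1 ∈ P ∧ (tetraPick P x).2 ∈ P ∧ TetraAt x (tetraPick P x).1 (tetraPick P x).2 ∧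
    ∀ {w₁ w₂ w₃ : T3}, w₁ ∈ S → w₂ ∈ S → w₃ ∈ S → UnitTriple w₁ w₂ w₃ →
      RegAt P S x (tneg x) (tsub (tetraPick P x).1 x) (tsub (tetraPick P x).2 x) w₁ w₂ w₃ →
      StarPulls XP XS (tneg x) (tsub (tetraPick P x).1 x) (tsub (tetraPick P x).2 x) w₁ w₂ w₃ := by
  simp only [starKernelB, Bool.and_eq_true] at h
  obtain ⟨hok, h⟩ := h
  obtain ⟨hb, hc, ht⟩ := tetraOkB_sound hok
  refine ⟨hb, hc, ht, ?_⟩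
  intro w₁ w₂ w₃ hw₁ hw₂ hw₃ hu hreg
  obtain ⟨h₁, h₂, h₁₂, h₃, h₁₃, h₂₃⟩ := hu
  simp only [List.all_eq_true, impB_eq_true, Bool.and_eq_true, beq_iff_eq] at h
  exact starPulls_of_starConclB (h w₁ hw₁ h₁ w₂ hw₂ ⟨h₂, h₁₂⟩ w₃ hw₃ ⟨⟨h₃, h₁₃⟩, h₂₃⟩ (regB_of_regAt hreg))

/-- Soundness, list form. [this file] -/
theorem starKernelListB_sound {P xs S XP XS : List T3} (h : starKernelListB P xs S XP XS = true) {x : T3} (hx : x ∈ xs) :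
    (tetraPick P x).1 ∈ P ∧ (tetraPick P x).2 ∈ P ∧ TetraAt x (tetraPick P x).1 (tetraPick P x).2 ∧
    ∀ {w₁ w₂ w₃ : T3}, w₁ ∈ S → w₂ ∈ S → w₃ ∈ S → UnitTriple w₁ w₂ w₃ →
      RegAt P S x (tneg x) (tsub (tetraPick P x).1 x) (tsub (tetraPick P x).2 x) w₁ w₂ w₃ →
      StarPulls XP XS (tneg x) (tsub (tetraPick P x).1 x) (tsub (tetraPick P x).2 x) w₁ w₂ w₃ :=
  starKernelB_sound ((List.all_eq_true.1 h) x hx)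

/-! ## §3  (K3) representation search and the own-face search -/

/-- Labels of `P` within the exact dictionary's reach of `x` (`0 < tsq (v − x) ≤ 36`, i.e. `0 < ‖v − x‖ ≤ √2 ≤ 149/100`). [this file] -/
def reachL (P : List T3) (x : T3) : List T3 :=
  P.filter fun v => decide (0 < tsq (tsub v x)) && decide (tsq (tsub v x) ≤ 36)

/-- FACE-TYPE representation `X = s · (−x + (v_a − x) + (v_b − x))`, `s = ±2` (thirds: the `±(2/3)(w₀ + w_a + w_b)` faces of memo §5 (K3);
link `…RunCutBondLink.face_link_record`). [this file] -/
def faceRepB (P : List T3) (x X : T3) : Bool :=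
  [(2 : ℤ), -2].any fun s => (reachL P x).any fun va => (reachL P x).any fun vb =>
    teq X (tscale s (tadd (tadd (tneg x) (tsub va x)) (tsub vb x)))

/-- QUAD-TYPE representation `X = 2s(v_a − x) + s(v_b − x) − 2s(v_c − x) − s(v_d − x)`, `s = ±1` (thirds: moduli `2/3, 1/3, 2/3, 1/3`, zero sum —
the non-face fcc lines and, with `v_a = v_b`, `v_c = v_d`, the hcp basal bonds; link `…RunCutBondLink.quad_link_record`); the fourth label is solved
for and looked up. [this file] -/
def quadRepB (P : List T3) (x X : T3) : Bool :=
  [(1 : ℤ), -1].any fun s => (reachL P x).any fun va => (reachL P x).any fun vb => (reachL P x).any fun vc =>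
    let T := tsub (tsub (tadd (tscale (2 * s) (tsub va x)) (tscale s (tsub vb x))) (tscale (2 * s) (tsub vc x))) X
    (reachL P x).any (teq (tadd x (tscale s T)))

/-- The (K3) representation search. [this file] -/
def repB (P : List T3) (x X : T3) : Bool := faceRepB P x X || quadRepB P x X

/-- OWN-FACE search: `X = s · (u₁ + u₂ + u₃)` with `s = ±2` and first-shell `uᵢ ∈ P`. [this file] -/
def ownFaceB (P : List T3) (X : T3) : Bool :=
  [(2 : ℤ), -2].any fun s => (shellL P).any fun u₁ => (shellL P).any fun u₂ => (shellL P).any fun u₃ =>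
    teq X (tscale s (tadd (tadd u₁ u₂) u₃))

/-- Membership in `reachL`. [this file] -/
theorem mem_reachL {P : List T3} {x v : T3} : v ∈ reachL P x ↔ v ∈ P ∧ 0 < tsq (tsub v x) ∧ tsq (tsub v x) ≤ 36 := by
  simp [reachL, List.mem_filter, Bool.and_eq_true, decide_eq_true_eq]

/-- Membership in `shellL`. [this file] -/
theorem mem_shellL {P : List T3} {v : T3} : v ∈ shellL P ↔ v ∈ P ∧ tsq v = 18 := by
  simp [shellL, List.mem_filter, beq_iff_eq]

/-- **REACH, REAL FORM**: a label within integer reach is a pattern label `≠ mv x` within the exact dictionary's `149/100`. [this file] -/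
theorem reach_real {x v : T3} (h : 0 < tsq (tsub v x) ∧ tsq (tsub v x) ≤ 36) : mv v ≠ mv x ∧ ‖mv v - mv x‖ ≤ 149 / 100 := by
  obtain ⟨h0, h36⟩ := h
  have hsq : ‖mv v - mv x‖ ^ 2 = (tsq (tsub v x) : ℝ) / 18 := by rw [← mv_tsub, norm_mv_sq]
  have h36R : (tsq (tsub v x) : ℝ) ≤ 36 := by exact_mod_cast h36
  have h0R : (0 : ℝ) < tsq (tsub v x) := by exact_mod_cast h0
  constructor
  · intro e
    rw [e, sub_self, norm_zero] at hsq
    have : (tsq (tsub v x) : ℝ) = 0 := by linarith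
    linarith
  · nlinarith [norm_nonneg (mv v - mv x)]

/-- Componentwise equality on `T3`. [this file] -/
private theorem t3_ext {a b : T3} (h1 : a.1 = b.1) (h2 : a.2.1 = b.2.1) (h3 : a.2.2 = b.2.2) : a = b :=
  Prod.ext h1 (Prod.ext h2 h3)

/-- Solving the quad search's look-up for `X` (uses `s² = 1`). [this file] -/
private theorem quad_solve {s : ℤ} (hs : s = 1 ∨ s = -1) {x X va vb vc vd : T3}
    (hT : tadd x (tscale s (tsub (tsub (tadd (tscale (2 * s) (tsub va x)) (tscale s (tsub vb x))) (tscale (2 * s) (tsub vc x))) X)) = vd) :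
    X = tadd (tadd (tscale (2 * s) (tsub va x)) (tscale s (tsub vb x))) (tadd (tscale (-(2 * s)) (tsub vc x)) (tscale (-s) (tsub vd x))) := by
  obtain ⟨x₁, x₂, x₃⟩ := x
  obtain ⟨a₁, a₂, a₃⟩ := va
  obtain ⟨b₁, b₂, b₃⟩ := vb
  obtain ⟨c₁, c₂, c₃⟩ := vc
  obtain ⟨d₁, d₂, d₃⟩ := vd
  obtain ⟨X₁, X₂, X₃⟩ := X
  simp only [tadd, tsub, tscale, Prod.mk.injEq] at hT
  obtain ⟨e₁, e₂, e₃⟩ := hT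
  refine t3_ext ?_ ?_ ?_ <;> simp only [tadd, tsub, tscale] <;> rcases hs with rfl | rfl <;> linarith

/-- **FACE REPRESENTATION, REAL FORM**: `faceRepB` delivers labels `v_a, v_b ∈ P` within the dictionary's reach and a coefficient `|c| = 2/3` with
`(1/3)·mv X = −(c·mv x) + c·(mv v_a − mv x) + c·(mv v_b − mv x)` — the parent-side vector of `…RunCutBondLink.face_link` /`combo3_bound`. [this file] -/
theorem face_real_of_faceRepB {P : List T3} {x X : T3} (h : faceRepB P x X = true) :
    ∃ (c : ℝ) (va vb : T3), |c| = 2 / 3 ∧ (va ∈ P ∧ vb ∈ P) ∧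
      ((mv va ≠ mv x ∧ ‖mv va - mv x‖ ≤ 149 / 100) ∧ (mv vb ≠ mv x ∧ ‖mv vb - mv x‖ ≤ 149 / 100)) ∧
      (1 / 3 : ℝ) • mv X = -(c • mv x) + c • (mv va - mv x) + c • (mv vb - mv x) := by
  simp only [faceRepB, List.any_eq_true, teq_eq_true] at h
  obtain ⟨s, hs, va, hva, vb, hvb, hX⟩ := h
  rw [mem_reachL] at hva hvb
  have hs' : s = 2 ∨ s = -2 := by simpa using hs
  refine ⟨(s : ℝ) / 3, va, vb, ?_, ⟨hva.1, hvb.1⟩, ⟨reach_real hva.2, reach_real hvb.2⟩, ?_⟩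
  · rcases hs' with rfl | rfl <;> norm_num [abs_div]
  · rw [hX]
    simp only [mv_tscale, mv_tadd, mv_tneg, mv_tsub]
    module

/-- **QUAD REPRESENTATION, REAL FORM**: `quadRepB` delivers four labels within reach and coefficients of moduli `2/3, 1/3, 2/3, 1/3` with zero sum and
`(1/3)·mv X = Σ c_r·(mv v_r − mv x)` — the parent-side vector of `…RunCutBondLink.quad_link` / `combo4_bound`. [this file] -/
theorem quad_real_of_quadRepB {P : List T3} {x X : T3} (h : quadRepB P x X = true) :
    ∃ (ca cb cc cd : ℝ) (va vb vc vd : T3), (|ca| = 2 / 3 ∧ |cb| = 1 / 3 ∧ |cc| = 2 / 3 ∧ |cd| = 1 / 3 ∧ ca + cb + cc + cd = 0) ∧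
      (va ∈ P ∧ vb ∈ P ∧ vc ∈ P ∧ vd ∈ P) ∧
      ((mv va ≠ mv x ∧ ‖mv va - mv x‖ ≤ 149 / 100) ∧ (mv vb ≠ mv x ∧ ‖mv vb - mv x‖ ≤ 149 / 100) ∧
        (mv vc ≠ mv x ∧ ‖mv vc - mv x‖ ≤ 149 / 100) ∧ (mv vd ≠ mv x ∧ ‖mv vd - mv x‖ ≤ 149 / 100)) ∧
      (1 / 3 : ℝ) • mv X = ca • (mv va - mv x) + cb • (mv vb - mv x) + cc • (mv vc - mv x) + cd • (mv vd - mv x) := by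
  simp only [quadRepB, List.any_eq_true, teq_eq_true] at h
  obtain ⟨s, hs, va, hva, vb, hvb, vc, hvc, vd, hvd, hT⟩ := h
  rw [mem_reachL] at hva hvb hvc hvd
  have hs' : s = 1 ∨ s = -1 := by simpa using hs
  refine ⟨2 * (s : ℝ) / 3, (s : ℝ) / 3, -(2 * (s : ℝ)) / 3, -(s : ℝ) / 3, va, vb, vc, vd, ?_, ⟨hva.1, hvb.1, hvc.1, hvd.1⟩,
    ⟨reach_real hva.2, reach_real hvb.2, reach_real hvc.2, reach_real hvd.2⟩, ?_⟩
  · rcases hs' with rfl | rfl <;> norm_num [abs_div]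
  · rw [quad_solve hs' hT]
    simp only [mv_tscale, mv_tadd, mv_tsub]
    push_cast
    module

/-- **OWN FACE, REAL FORM**: `ownFaceB` delivers three first-shell labels of `P` (unit model points) and `|c| = 2/3` with `(1/3)·mv X = c·mv u₁ + c·mv u₂ + c·mv u₃`
(the combination of `…RunCutBondLink.near_isometry_combo3`, moduli summing to `2`). [this file] -/
theorem ownFace_real_of_ownFaceB {P : List T3} {X : T3} (h : ownFaceB P X = true) :
    ∃ (c : ℝ) (u₁ u₂ u₃ : T3), |c| = 2 / 3 ∧ (u₁ ∈ P ∧ u₂ ∈ P ∧ u₃ ∈ P) ∧ (‖mv u₁‖ = 1 ∧ ‖mv u₂‖ = 1 ∧ ‖mv u₃‖ = 1) ∧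
      (1 / 3 : ℝ) • mv X = c • mv u₁ + c • mv u₂ + c • mv u₃ := by
  simp only [ownFaceB, List.any_eq_true, teq_eq_true] at h
  obtain ⟨s, hs, u₁, hu₁, u₂, hu₂, u₃, hu₃, hX⟩ := h
  rw [mem_shellL] at hu₁ hu₂ hu₃
  have hs' : s = 2 ∨ s = -2 := by simpa using hs
  refine ⟨(s : ℝ) / 3, u₁, u₂, u₃, ?_, ⟨hu₁.1, hu₂.1, hu₃.1⟩,
    ⟨(norm_mv_eq_one_iff _).2 hu₁.2, (norm_mv_eq_one_iff _).2 hu₂.2, (norm_mv_eq_one_iff _).2 hu₃.2⟩, ?_⟩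
  · rcases hs' with rfl | rfl <;> norm_num [abs_div]
  · rw [hX]
    simp only [mv_tscale, mv_tadd]
    module

/-! ## §4  The tables (kernel computation) -/

/-- **(K1) fcc parent, fcc child**: along any of the twelve bonds, each of the parent's four star lines is the dictionary image of a child star line.
[this file, by `decide +kernel`] -/
theorem sk_ff : starKernelListB fccL (shellL fccL) fccL XF XF = true := by
  decide +kernel

/-- **(K1) fcc parent, hcp child**: each of the parent's four lines is the image of a member of the child's hcp star `XH`. [this file, by `decide +kernel`] -/
theorem sk_fh : starKernelListB fccL (shellL fccL) hcpL XF XH = true := by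
  decide +kernel

/-- **(K1) hcp parent, fcc child** (cap bonds; basal bonds register no fcc child, vacuously): the parent's AXIS is the image of a child fcc line.
[this file, by `decide +kernel`] -/
theorem sk_hf : starKernelListB hcpL (shellL hcpL) fccL XHax XF = true := by
  decide +kernel

/-- **(K1) hcp parent, hcp child**, all twelve bonds: the parent's axis is the image of a member of the child's star `XH` (by `XH_dichotomy`: the child's
`±`axis — ALIGNED — or a side member at model cosine `±1/3` — the first-foreign KILL of part 23C). [this file, by `decide +kernel`] -/
theorem sk_hh : starKernelListB hcpL (shellL hcpL) hcpL XHax XH = true := by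
  decide +kernel

/-- Refinement for BASAL bonds (in-layer, cf. `…KernelGrowth.e1_table`): the axis is carried to the child's axis exactly. [this file, by `decide +kernel`] -/
theorem sk_hh_basal : starKernelListB hcpL hexL hcpL XHax XHax = true := by
  decide +kernel

/-- **THE NEVER-ARISING ROW** (memo §5: the 36 violations; critic row 1621 (D) pre-registration): an hcp parent does NOT carry its SIDE members across a
cap bond into the child's star — kernel value `false` (the twin bookkeeping of memo §0 (C2); on a leg the carried member at an h-site is the axis, else
the site is killed). [this file, by `decide +kernel`] -/
theorem sk_hh_side_false : starKernelListB hcpL (capL hcpL 1 ++ capL hcpL (-1)) hcpL XH XH = false := by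
  decide +kernel

/-- **(K3) TABLE**: every (bond, star member) the legs need has a representation found by `repB` — fcc parent: all twelve bonds × the eight members of
`XF` (48 face-type, 48 quad-type); hcp parent: all twelve bonds × the axis `XHax` (caps: face-type; basal: quad-type). [this file, by `decide +kernel`] -/
theorem rep_table :
    ((shellL fccL).all fun x => XF.all fun X => repB fccL x X) = true ∧
    ((shellL hcpL).all fun x => XHax.all fun X => repB hcpL x X) = true := by
  constructor <;> decide +kernel

/-- **OWN-FACE TABLE**: every member of `XF` (resp. `XH`) is `±2(u₁ + u₂ + u₃)` over first-shell points of `fccL` (resp. `hcpL`). [this file, by `decide +kernel`] -/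
theorem ownFace_table : (XF.all fun X => ownFaceB fccL X) = true ∧ (XH.all fun X => ownFaceB hcpL X) = true := by
  constructor <;> decide +kernel

/-! ## §5  Bridge to `E3` -/

/-- ★★ **STAR STEP** (the analogue of `…CompressedCutCharts.kernel_step_one`).  A table entry `starKernelListB Cp xs S XP XS = true`, a parent with pattern
`Pp` carried onto `Cp` by `Gp`, a child along `v_k ↦ x ∈ xs` (`‖v_k‖ = 1`), a chart-form dictionary towards the child chart `G`, the child's pattern `P'`
listed by `S ∈ {fccL, hcpL}`: then EVERY parent star member `X ∈ XP` is `G (mv Y)` for some child star member `Y ∈ XS`.  On a leg `Gp = id`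
(`carries_id_of_listedBy`) and `G = id ∘ R₁` (`chartDict_of_exactDict`), so `R₁ (mv Y) = mv X`. [this file] -/
theorem star_step_one {Cp xs S XP XS : List T3} (hK : starKernelListB Cp xs S XP XS = true)
    {G Gp : EuclideanSpace ℝ (Fin 3) →ₗᵢ[ℝ] EuclideanSpace ℝ (Fin 3)} {Pp P' : Finset (EuclideanSpace ℝ (Fin 3))} {vkp : EuclideanSpace ℝ (Fin 3)} {x : T3}
    (hx : x ∈ xs) (hD : ChartDict G Gp Pp vkp P') (hCp : Carries Gp Pp Cp) (hGx : Gp vkp = mv x) (hvk1 : ‖vkp‖ = 1)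
    (hS : S = fccL ∨ S = hcpL) (hL : ListedBy P' S) : ∀ X ∈ XP, ∃ Y ∈ XS, G (mv Y) = mv X := by
  obtain ⟨hb, hc, ht, hmain⟩ := starKernelListB_sound hK hx
  obtain ⟨W₁, hW₁, W₂, hW₂, W₃, hW₃, hu, e₁, e₂, e₃⟩ := exists_unitTriple_of_chartDict hD hCp.2 hGx hvk1 hb hc ht hL.1
  have hd : tdet W₁ W₂ W₃ ≠ 0 := by
    rcases tdet_of_unitTriple hS hW₁ hW₂ hW₃ hu with h | h <;> rw [h] <;> norm_num
  have hpull := mv_tpull e₁ e₂ e₃ hd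
  have hP := hmain hW₁ hW₂ hW₃ hu (regAt_of_chartDict hD hCp.2 hGx hL.1 hpull)
  intro X hX
  obtain ⟨Y, hY, hYX⟩ := hP X hX
  have hdR : (tdet W₁ W₂ W₃ : ℝ) ≠ 0 := by exact_mod_cast hd
  refine ⟨Y, hY, smul_right_injective (EuclideanSpace ℝ (Fin 3)) hdR ?_⟩
  show (tdet W₁ W₂ W₃ : ℝ) • G (mv Y) = (tdet W₁ W₂ W₃ : ℝ) • mv X
  rw [← hpull, hYX, mv_tscale]

/-- **NORM OF A STAR MEMBER**: `tsq X = 432` gives `‖(1/3) • mv X‖² = 8/3` (the hypothesis of `…RunCutBondLink.norm_face_lower`). [this file] -/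
theorem norm_third_mv_sq {X : T3} (h : tsq X = 432) : ‖(1 / 3 : ℝ) • mv X‖ ^ 2 = 8 / 3 := by
  rw [norm_smul, mul_pow, norm_mv_sq, h]
  norm_num

/-- **MODEL INNER PRODUCTS**: `⟪mv a, mv b⟫ = tdot a b / 18` (so `XH_dichotomy`'s `tdot = ±144` is model cosine `±1/3` at `tsq = 432`). [this file] -/
theorem inner_mv (a b : T3) : ⟪mv a, mv b⟫_ℝ = (tdot a b : ℝ) / 18 := by
  have h18 : (Real.sqrt 18)⁻¹ * (Real.sqrt 18)⁻¹ = (18 : ℝ)⁻¹ := by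
    rw [← mul_inv, Real.mul_self_sqrt (by norm_num : (0 : ℝ) ≤ 18)]
  obtain ⟨a₁, a₂, a₃⟩ := a
  obtain ⟨b₁, b₂, b₃⟩ := b
  simp only [mv]
  rw [real_inner_smul_left, real_inner_smul_right, ← mul_assoc, h18, EuclideanSpace.inner_eq_star_dotProduct, dotProduct,
    Fin.sum_univ_three]
  simp [intVec, tdot]
  ring

/-- The axis at scale `×3`: `mv (12,12,12) = 3 • mv (4,4,4)` (the engine's `N m` is the unit vector of `A_m (mv (4,4,4))`). [this file] -/
theorem mv_axis_three : mv (12, 12, 12) = (3 : ℝ) • mv (4, 4, 4) := by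
  have h : ((12 : ℤ), (12 : ℤ), (12 : ℤ)) = tscale 3 (4, 4, 4) := by decide
  rw [h, mv_tscale]
  norm_num

end Summit.AtomisticToContinuum.Crystallization.Theorems.OverbindingBudgetAffineRunCutStarKernel
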